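import Mathlib
import Summits.NavierStokesRegularity.FluidComputer.BeltramiSextuplet
import Literature.Analysis.FluidPDE.ClassicalSolutionGalilean
import HarnessLib

/-!
# The rigidly wobbling Beltrami host (LEMMA W): exact forced solution, its fixed sextuplet
# directions, and its co-moving form «steady pattern + uniform wind»

HONEST FRAMING (cell `ns-blowup`, seat `ns-blowup-instab`, human ruling D-0035): nothing here is a
claim about Navier–Stokes blow-up. WHAT THIS IS NOT: not a statement about the marginal tower N1*;
it is the kernel form of LEMMA W of `instab/X1pp-SKENE-TOBIAS.md` about ONE printed MODEL host, the
«wobbling» ABC flow of Brummell–Cattaneo–Tobias (Fluid Dyn. Res. 28 (2001) 237) and Skene–Tobias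
(Phys. Rev. Fluids 8 (2023) 083701, §II.A: `U₀ = (sin(z + ε sin Ωt) + cos(y + ε sin Ωt), …)` — the
SAME phase in all three arguments), which the cell's planner recorded as the typed FORM of the crux
X1″ («growing co-signed Floquet rope about a time-periodic host»).

* §1 (`hasDerivAt_comp_translate`) the time derivative of a rigidly translated pattern,
  `d/dt U(x + a(t)e) = a'(t) · DU(x + a(t)e)[e]`.
* §2 **LEMMA W1** (`isClassicalNSSolutionOn_wobblingHost`): for smooth divergence-free strong
  Beltrami fields `U`, `b` with the same coefficient `λ̄`, ANY smooth amplitude `a : ℝ → ℝ` and any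
  direction `e`, the pair `u(t, x) = U(x + a(t)e) + e^{−νλ̄²t} b(x)`, `p = −½|u|²` is a classical
  solution of the Navier–Stokes system on `ℝ³ × ℝ` with force
  `f(t, x) = νλ̄² U(x + a(t)e) + a'(t) · DU(x + a(t)e)[e]`. With `b = 0`
  (`isClassicalNSSolutionOn_wobblingHost_self`) this is the statement that the wobbling host is an
  exact forced solution and identifies the force of Skene–Tobias («F chosen such that U₀ is a
  solution»): the viscous maintenance `νλ̄²U₀` plus the NON-potential drive `a'(t)∂ₑU₀`. With
  `b ≠ 0` it says MORE: every FIXED (non-translating) strong Beltrami field of the same `λ̄` — for the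
  ABC host, every member of the six-dimensional `(+)`-helical unit shell (`BeltramiSextuplet`) — is
  an exact `−νλ̄²` direction of the flow linearised about the WOBBLING host as well
  (`isClassicalNSSolutionOn_abc_wobbling`): KILLSHEET XIII.0 survives the wobble verbatim, the
  Floquet multiplier of the sextuplet is `e^{−νλ̄²T}` exactly (the engine check of kit j238644:
  multiplier 0.88191138 = e^{−T/100}, relative error 7e-15).
* §3 **LEMMA W2** (`isClassicalNSSolutionOn_wobblingHost_comoving`): boosting W1 into the frame of
  the pattern with the tree's extended Galilean covariance
  (`IsClassicalNSSolutionOn.galileanBoost`, frame path `ξ(t) = −a(t)e`) exhibits the co-moving form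
  of the host: `V(t, y) = U(y) + a'(t)e` — the STEADY Beltrami pattern plus a spatially UNIFORM
  oscillatory wind — with force `νλ̄²U(y) + a'(t)·DU(y)[e]` and pressure `−½|U(y)|² + a''(t)⟪e, y⟫`.
  So the host's vorticity is the steady field `λ̄U(y)`, its entire time dependence is a uniform slip
  of fluid through a force-pinned pattern, and NS linearised about it is `L_U − a'(t)(e·∇)` (memo §2;
  the two formulations agree to 1e-14 over a period in kit j238644). Since a uniform time-dependent
  sweep of an UNFORCED flow is removable by the same covariance (`galileanBoost_zero`), this
  time dependence has no counterpart at an unforced (inherited) tower level — the reading (G) of the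
  memo; the theorem here only displays the co-moving form.

All statements are pointwise identities over the tree's `IsClassicalNSSolutionOn`, `IsBeltrami`,
`ABC.abc`, `convect`, `gradient`; no spectral claim. References: Brummell–Cattaneo–Tobias 2001;
Skene–Tobias 2023 §II; Majda–Bertozzi 2002 §1.2 (Galilean invariance), §2.3.2 (Beltrami/ABC);
cell files `instab/X1pp-SKENE-TOBIAS.md`, `KILLSHEET.md` §XIII.0.
-/

noncomputable section

open Set Real InnerProductSpace
open scoped RealInnerProductSpace ContDiff Laplacian Topology

namespace Summit.NavierStokesRegularity.FluidComputer.WobblingBeltramiHost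

open Literature.Analysis.FluidPDE Literature.Analysis.FluidPDE.ABC BeltramiHostLinearisation
  BeltramiSextuplet

/-! ### §1 Calculus of the rigid translate -/

/-- Time derivative of a rigidly translated pattern: `d/dt U(x + a(t)e) = a'(t) · DU(x + a(t)e)[e]`. -/
theorem hasDerivAt_comp_translate {U : EuclideanSpace ℝ (Fin 3) → EuclideanSpace ℝ (Fin 3)}
    (hUd : Differentiable ℝ U) {a : ℝ → ℝ} (had : Differentiable ℝ a)
    (e x : EuclideanSpace ℝ (Fin 3)) (t : ℝ) :
    HasDerivAt (fun s => U (x + a s • e)) (deriv a t • fderiv ℝ U (x + a t • e) e) t := by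
  have hin : HasDerivAt (fun s => x + a s • e) (deriv a t • e) t :=
    ((had t).hasDerivAt.smul_const e).const_add x
  have h := ((hUd (x + a t • e)).hasFDerivAt).comp_hasDerivAt t hin
  rw [map_smul] at h
  exact h

/-- Joint smoothness of `(t, x) ↦ U(x + a(t)e)` for smooth `U`, `a`. -/
theorem contDiff_uncurry_translate {U : EuclideanSpace ℝ (Fin 3) → EuclideanSpace ℝ (Fin 3)}
    (hUs : ContDiff ℝ ∞ U) {a : ℝ → ℝ} (ha : ContDiff ℝ ∞ a) (e : EuclideanSpace ℝ (Fin 3)) :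
    ContDiff ℝ ∞ (fun q : ℝ × EuclideanSpace ℝ (Fin 3) => U (q.2 + a q.1 • e)) :=
  hUs.comp (contDiff_snd.add ((ha.comp contDiff_fst).smul contDiff_const))

/-! ### §2 LEMMA W1 — the wobbling host and its fixed Beltrami directions are exact forced solutions -/

/-- **LEMMA W1.** For smooth divergence-free strong Beltrami fields `U`, `b` with coefficient `λ̄`,
a smooth amplitude `a` and a direction `e`, `u(t, x) = U(x + a(t)e) + e^{−νλ̄²t} b(x)` with
`p = −½|u|²` solves the Navier–Stokes system on `ℝ³ × ℝ` with force
`νλ̄² U(x + a(t)e) + a'(t) · DU(x + a(t)e)[e]`: the rigidly wobbling pattern is maintained by the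
viscous force plus the non-potential drive `a'∂ₑU`, and every FIXED Beltrami field `b` of the same
`λ̄` decays at the exact rate `νλ̄²` on top of it (the slice `u(t)` is strong Beltrami, so
`(u·∇)u = ∇½|u|²` and `Δu = −λ̄²u`). -/
theorem isClassicalNSSolutionOn_wobblingHost {U b : EuclideanSpace ℝ (Fin 3) → EuclideanSpace ℝ (Fin 3)}
    {lam0 : ℝ} (ν : ℝ) {a : ℝ → ℝ} (ha : ContDiff ℝ ∞ a) (e : EuclideanSpace ℝ (Fin 3))
    (hU : IsBeltrami U fun _ => lam0) (hb : IsBeltrami b fun _ => lam0)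
    (hUs : ContDiff ℝ ∞ U) (hbs : ContDiff ℝ ∞ b)
    (hUdiv : VectorCalculus.IsDivFree U) (hbdiv : VectorCalculus.IsDivFree b) :
    IsClassicalNSSolutionOn univ ν
      (fun t x => (ν * lam0 ^ 2) • U (x + a t • e) + deriv a t • fderiv ℝ U (x + a t • e) e)
      (fun t x => U (x + a t • e) + exp (-(lam0 ^ 2 * ν) * t) • b x)
      (fun t x => -(‖U (x + a t • e) + exp (-(lam0 ^ 2 * ν) * t) • b x‖ ^ 2 / 2)) := by
  have hUd : Differentiable ℝ U := hUs.differentiable (by simp)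
  have hbd : Differentiable ℝ b := hbs.differentiable (by simp)
  have had : Differentiable ℝ a := ha.differentiable (by simp)
  -- joint smoothness of the velocity
  have hsu : ContDiff ℝ ∞ (fun q : ℝ × EuclideanSpace ℝ (Fin 3) =>
      U (q.2 + a q.1 • e) + exp (-(lam0 ^ 2 * ν) * q.1) • b q.2) :=
    (contDiff_uncurry_translate hUs ha e).add
      ((contDiff_exp.comp (contDiff_const.mul contDiff_fst)).smul (hbs.comp contDiff_snd))
  refine ⟨hsu.contDiffOn, (((hsu.norm_sq ℝ).div_const 2).neg).contDiffOn, ?_, ?_⟩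
  · -- the momentum equation
    intro t _ x
    set c : ℝ := exp (-(lam0 ^ 2 * ν) * t) with hc
    set s : EuclideanSpace ℝ (Fin 3) := a t • e with hs
    -- the slice `u(t)` is a smooth divergence-free strong Beltrami field
    have hUt : IsBeltrami (fun y => U (y + s)) fun _ => lam0 := hU.translate s
    have hUts : ContDiff ℝ ∞ (fun y => U (y + s)) := contDiff_translate hUs s
    have hUtd : Differentiable ℝ (fun y => U (y + s)) := hUts.differentiable (by simp)
    have hUtdiv : VectorCalculus.IsDivFree (fun y => U (y + s)) := isDivFree_translate hUdiv s
    have hut : IsBeltrami (fun y => U (y + s) + c • b y) fun _ => lam0 :=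
      hUt.add (hb.const_smul hbd c) hUtd (hbd.const_smul c)
    have huts : ContDiff ℝ ∞ (fun y => U (y + s) + c • b y) := hUts.add (hbs.const_smul c)
    have hut2 : ContDiff ℝ 2 (fun y => U (y + s) + c • b y) := contDiff_infty.1 huts 2
    have hutd : DifferentiableAt ℝ (fun y => U (y + s) + c • b y) x :=
      (huts.differentiable (by simp)) x
    have hcbd : Differentiable ℝ (fun y => c • b y) := (hbs.const_smul c).differentiable (by simp)
    have hutdiv : VectorCalculus.IsDivFree (fun y => U (y + s) + c • b y) := fun y => by
      rw [RingCorrector.divergence_add (hUtd y) (hcbd y),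
        divergence_const_smul_of_differentiableAt (hbd y) c, hUtdiv y, hbdiv y, mul_zero, add_zero]
    -- time derivative
    have h1 : timeDerivWithin univ
        (fun r y => U (y + a r • e) + exp (-(lam0 ^ 2 * ν) * r) • b y) t x =
        deriv a t • fderiv ℝ U (x + s) e + (c * (-(lam0 ^ 2 * ν))) • b x := by
      rw [timeDerivWithin_apply, derivWithin_univ]
      have hd : HasDerivAt (fun r : ℝ => -(lam0 ^ 2 * ν) * r) (-(lam0 ^ 2 * ν)) t := by
        simpa using (hasDerivAt_id t).const_mul (-(lam0 ^ 2 * ν))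
      have h := (hasDerivAt_comp_translate hUd had e x t).add (hd.exp.smul_const (b x))
      exact h.deriv
    -- convective term
    have h2 : convect (fun y => U (y + s) + c • b y) (fun y => U (y + s) + c • b y) x =
        gradient (fun y => ‖U (y + s) + c • b y‖ ^ 2 / 2) x := hut.convect_eq_gradient hutd
    -- viscous term
    have h3 : Δ (fun y => U (y + s) + c • b y) x = -(lam0 ^ 2) • (U (x + s) + c • b x) :=
      laplacian_eq_of_strongBeltrami hut hut2 hutdiv x
    -- pressure term
    have h4 : gradient (fun y => -(‖U (y + s) + c • b y‖ ^ 2 / 2)) x =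
        -gradient (fun y => ‖U (y + s) + c • b y‖ ^ 2 / 2) x := gradient_fun_neg' _ x
    show timeDerivWithin univ (fun r y => U (y + a r • e) + exp (-(lam0 ^ 2 * ν) * r) • b y) t x +
        convect (fun y => U (y + s) + c • b y) (fun y => U (y + s) + c • b y) x =
      ν • Δ (fun y => U (y + s) + c • b y) x -
        gradient (fun y => -(‖U (y + s) + c • b y‖ ^ 2 / 2)) x +
        ((ν * lam0 ^ 2) • U (x + s) + deriv a t • fderiv ℝ U (x + s) e)
    rw [h1, h2, h3, h4]
    simp only [smul_add, smul_smul, sub_neg_eq_add]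
    ext i
    simp only [PiLp.add_apply, PiLp.smul_apply, smul_eq_mul]
    ring
  · -- incompressibility
    intro t _ y
    have hUtd : Differentiable ℝ (fun z => U (z + a t • e)) :=
      (contDiff_translate hUs (a t • e)).differentiable (by simp)
    have hcbd : Differentiable ℝ (fun z => exp (-(lam0 ^ 2 * ν) * t) • b z) :=
      (hbs.const_smul _).differentiable (by simp)
    show VectorCalculus.divergence
      (fun z => U (z + a t • e) + exp (-(lam0 ^ 2 * ν) * t) • b z) y = 0
    rw [RingCorrector.divergence_add (hUtd y) (hcbd y),
      divergence_const_smul_of_differentiableAt (hbd y), isDivFree_translate hUdiv (a t • e) y,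
      hbdiv y, mul_zero, add_zero]

/-- **The wobbling host alone** (`b = 0`): `U₀(t, x) = U(x + a(t)e)` with `p = −½|U₀|²` solves the
Navier–Stokes system with force `νλ̄²U₀ + a'(t)∂ₑU₀` — the force «chosen such that U₀ is an exact
time-periodic solution» of Skene–Tobias 2023 §II.A, made explicit. -/
theorem isClassicalNSSolutionOn_wobblingHost_self
    {U : EuclideanSpace ℝ (Fin 3) → EuclideanSpace ℝ (Fin 3)} {lam0 : ℝ} (ν : ℝ) {a : ℝ → ℝ}
    (ha : ContDiff ℝ ∞ a) (e : EuclideanSpace ℝ (Fin 3)) (hU : IsBeltrami U fun _ => lam0)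
    (hUs : ContDiff ℝ ∞ U) (hUdiv : VectorCalculus.IsDivFree U) :
    IsClassicalNSSolutionOn univ ν
      (fun t x => (ν * lam0 ^ 2) • U (x + a t • e) + deriv a t • fderiv ℝ U (x + a t • e) e)
      (fun t x => U (x + a t • e)) (fun t x => -(‖U (x + a t • e)‖ ^ 2 / 2)) := by
  have hb0 : IsBeltrami (fun _ : EuclideanSpace ℝ (Fin 3) => (0 : EuclideanSpace ℝ (Fin 3)))
      fun _ => lam0 := fun x => by simp
  have hdiv0 : VectorCalculus.IsDivFree
      (fun _ : EuclideanSpace ℝ (Fin 3) => (0 : EuclideanSpace ℝ (Fin 3))) := fun x => by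
    simp [VectorCalculus.divergence]
  have h := isClassicalNSSolutionOn_wobblingHost ν ha e hU hb0 hUs contDiff_const hUdiv hdiv0
  simp only [smul_zero, add_zero] at h
  exact h

/-- **ABC instance (the BCT/Skene–Tobias host and its sextuplet).** For the ABC host
`U = abc A B C` (`λ̄ = 1`), any smooth wobble amplitude `a`, any direction `e` (Skene–Tobias:
`A = B = C = 1`, `e = (1,1,1)`, `a(t) = ε sin Ωt`) and any FIXED second ABC field `abc A' B' C'`:
`u(t, x) = abc A B C (x + a(t)e) + e^{−νt} abc A' B' C' (x)` with `p = −½|u|²` solves the system with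
force `ν·abc A B C (x + a(t)e) + a'(t)·D(abc A B C)(x + a(t)e)[e]` exactly — the non-translating
sextuplet directions are exact `−ν` Floquet directions of the wobbling host (multiplier `e^{−νT}`). -/
theorem isClassicalNSSolutionOn_abc_wobbling (ν A B C A' B' C' : ℝ) {a : ℝ → ℝ}
    (ha : ContDiff ℝ ∞ a) (e : EuclideanSpace ℝ (Fin 3)) :
    IsClassicalNSSolutionOn univ ν
      (fun t x => ν • abc A B C (x + a t • e) + deriv a t • fderiv ℝ (abc A B C) (x + a t • e) e)
      (fun t x => abc A B C (x + a t • e) + exp (-ν * t) • abc A' B' C' x)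
      (fun t x => -(‖abc A B C (x + a t • e) + exp (-ν * t) • abc A' B' C' x‖ ^ 2 / 2)) := by
  have h := isClassicalNSSolutionOn_wobblingHost ν ha e (isBeltrami_abc A B C)
    (isBeltrami_abc A' B' C') (contDiff_abc A B C) (contDiff_abc A' B' C')
    (isDivFree_abc A B C) (isDivFree_abc A' B' C')
  simp only [one_pow, mul_one, one_mul] at h
  exact h

/-! ### §3 LEMMA W2 — the co-moving form: steady pattern plus uniform wind -/

/-- **LEMMA W2 (co-moving form of the wobbling host).** Boosting the exact solution
`U₀(t, x) = U(x + a(t)e)` of W1 into the frame of the pattern (`y = x + a(t)e`, i.e. the tree's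
`galileanBoost` with frame path `ξ(t) = −a(t)e` and gauge `0`) gives the classical solution
`V(t, y) = U(y) + a'(t)e` — the STEADY Beltrami pattern plus a spatially UNIFORM wind `a'(t)e` —
with force `νλ̄²U(y) + a'(t)·DU(y)[e]` and pressure `−½|U(y)|² + ⟪(−a)''(t)e, y⟫`. The host's
vorticity in this frame is the steady field `λ̄U`; all of its time dependence is uniform slip of
the fluid through the force-pinned pattern (memo §2: NS linearised about it is `L_U − a'(t)(e·∇)`). -/
theorem isClassicalNSSolutionOn_wobblingHost_comoving
    {U : EuclideanSpace ℝ (Fin 3) → EuclideanSpace ℝ (Fin 3)} {lam0 : ℝ} (ν : ℝ) {a : ℝ → ℝ}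
    (ha : ContDiff ℝ ∞ a) (e : EuclideanSpace ℝ (Fin 3)) (hU : IsBeltrami U fun _ => lam0)
    (hUs : ContDiff ℝ ∞ U) (hUdiv : VectorCalculus.IsDivFree U) :
    IsClassicalNSSolutionOn univ ν
      (fun t y => (ν * lam0 ^ 2) • U y + deriv a t • fderiv ℝ U y e)
      (fun t y => U y - deriv (fun r => -(a r • e)) t)
      (fun t y => -(‖U y‖ ^ 2 / 2) + ⟪deriv (deriv (fun r => -(a r • e))) t, y⟫ - 0) := by
  have h0 := isClassicalNSSolutionOn_wobblingHost_self ν ha e hU hUs hUdiv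
  have hξ : ContDiff ℝ ∞ (fun r : ℝ => -(a r • e)) := (ha.smul contDiff_const).neg
  have key := h0.galileanBoost uniqueDiffOn_univ hξ (g := fun _ => (0 : ℝ)) contDiff_const
  -- in the boosted frame `y + ξ t + a t • e = y`
  have hsimp : ∀ (t : ℝ) (y : EuclideanSpace ℝ (Fin 3)), y + -(a t • e) + a t • e = y :=
    fun t y => by rw [add_assoc, neg_add_cancel, add_zero]
  simp only [hsimp] at key
  exact key

/-- The uniform wind of W2 made explicit: `−d/dt(−a(t)e) = a'(t)e`, so the co-moving velocity of
`isClassicalNSSolutionOn_wobblingHost_comoving` is literally `U(y) + a'(t)e`. -/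
theorem comoving_velocity_eq {U : EuclideanSpace ℝ (Fin 3) → EuclideanSpace ℝ (Fin 3)}
    {a : ℝ → ℝ} (had : Differentiable ℝ a) (e y : EuclideanSpace ℝ (Fin 3)) (t : ℝ) :
    U y - deriv (fun r => -(a r • e)) t = U y + deriv a t • e := by
  have h : HasDerivAt (fun r => -(a r • e)) (-(deriv a t • e)) t :=
    ((had t).hasDerivAt.smul_const e).neg
  rw [h.deriv, sub_neg_eq_add]

end Summit.NavierStokesRegularity.FluidComputer.WobblingBeltramiHost
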